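import Mathlib
import HarnessLib

/-!
# Grothendieck's inequality in factorization form (named fact), with the symmetric
# one-weight form and Krivine's bound on the constant

Grothendieck's "théorème fondamental de la théorie métrique des produits tensoriels" (1953) in
the form used in applications to matrices (column/row weights):

* [Pisier2011, Theorem 2.1 "Classical GT/factorization", p. 9]: for compact `S, T` and a bounded
  bilinear form `φ : C(S) × C(T) → ℝ` there are PROBABILITIES `λ` on `S` and `μ` on `T` with
  `|φ(x,y)| ≤ K ‖φ‖ (∫|x|² dλ)^{1/2} (∫|y|² dμ)^{1/2}` for all `x, y`, "where `K` is a numerical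
  constant, the best value of which is denoted by `K_G`"; with `S = [m]`, `T = [n]`
  (`C(S) = ℓ^m_∞`) this is the statement that every real `m × n` matrix `A` admits nonnegative
  weights `μ, ν` of total mass `1` with
  `|∑ᵢⱼ Aᵢⱼ xᵢ yⱼ| ≤ K ‖A‖_{∞→1} (∑ᵢ μᵢxᵢ²)^{1/2} (∑ⱼ νⱼyⱼ²)^{1/2}` for all real `x, y`
  ([Tropp2008, Theorem 12 "Grothendieck Factorization", p. 10]: `A = D₁ T D₂`, `Dᵢ ≥ 0` diagonal,
  `tr Dᵢ² = 1`, `‖T‖ ≤ K_G ‖A‖_{∞→1}`, "When `G` is Hermitian, we may take `D₁ = D₂`").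
* [Pisier2011, §4, first display, p. 16] = Krivine (1979): `K_G^ℝ ≤ π / (2 log(1 + √2)) = 1.782…`
  ([Tropp2008, p. 10]: "`π/2 ≤ K_G(ℝ) ≤ π/(2 log(1+√2)) ≤ 1.783`").

Here `‖A‖_{∞→1} = sup {|∑ Aᵢⱼ xᵢ yⱼ| : ‖x‖_∞, ‖y‖_∞ ≤ 1}` is the norm of the bilinear form on
`ℓ^m_∞ × ℓ^n_∞`; since the form is affine in each coordinate separately, the supremum is attained
at sign vectors `x ∈ {±1}^m`, `y ∈ {±1}ⁿ` [folklore], and we state the hypothesis in that form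
(`|∑ Aᵢⱼ sᵢ tⱼ| ≤ M` for all sign vectors), which is how the norm is computed in applications
(cut norm, MAX-CUT relaxations).

## What is here

* `krivineBound := π / (2 log(1 + √2))` with `krivineBound_pos` and `krivineBound_lt_two` (proved:
  `exp(π/4) ≤ 1 + (π/4)(e − 1) < 1 + √2` by convexity of `exp` and the Mathlib decimal bounds on
  `π` and `e`).
* NAMED FACT `GrothendieckFactorization` (a `Prop`, not proved here — Grothendieck's inequality is
  not in Mathlib): the discrete real rectangular factorization with constant `krivineBound · M`.
* PROVED from the fact: `grothendieckFactorization_symm` — for a SYMMETRIC `A` one may take a single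
  weight `w = (μ + ν)/2` on both sides with the same constant (apply the fact to `(x,y)` and to
  `(y,x)`, multiply, and use `√a·√b ≤ (a+b)/2`); this is Tropp's "we may take `D₁ = D₂`".

## Design notes

* Weights are stated as SUB-probabilities (`∑ μᵢ ≤ 1`), which is what the printed probabilities
  give and which keeps the empty matrix (`m = 0` or `n = 0`, where no probability vector exists but
  the conclusion is `0 ≤ 0`) inside the statement without a side condition. Users (deletion /
  paving arguments: Markov's inequality on the weights) only ever use `∑ ≤ 1`.
* The constant is Krivine's bound rather than the (unknown) best constant `K_G`, so that the fact is
  a closed statement; it is therefore formally WEAKER than "[Pisier2011, Thm 2.1] with `K = K_G`"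
  combined with Krivine's theorem, and implied by them.
* Not here: the inequality form [Pisier2011, Thms 2.3/2.4] (Lindenstrauss–Pełczyński), the complex
  case, the little Grothendieck inequality, and any proof (Krivine's argument needs Grothendieck's
  identity `E sign⟨g,x⟩ sign⟨g,y⟩ = (2/π) arcsin⟨x,y⟩` for Gaussian vectors).
-/

namespace Literature.Analysis.Matrix

open Finset Real

/-- Krivine's upper bound `π / (2 log(1 + √2)) = 1.782…` for the real Grothendieck constant
`K_G^ℝ` (J.-L. Krivine, Adv. in Math. 31 (1979) 16–30). [cite: Pisier2011, §4 first display p. 16] -/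
noncomputable def krivineBound : ℝ := Real.pi / (2 * Real.log (1 + Real.sqrt 2))

/-- `log(1 + √2) > 0`. [folklore] -/
theorem log_one_add_sqrt_two_pos : 0 < Real.log (1 + Real.sqrt 2) :=
  Real.log_pos (by have := Real.sqrt_nonneg 2; nlinarith [Real.sqrt_pos.mpr (show (0:ℝ) < 2 by norm_num)])

/-- Krivine's bound is positive. [folklore] -/
theorem krivineBound_pos : 0 < krivineBound :=
  div_pos Real.pi_pos (mul_pos two_pos log_one_add_sqrt_two_pos)

/-- Krivine's bound is `< 2` (indeed `= 1.782…`); proof: `krivineBound < 2 ⟺ exp(π/4) < 1 + √2`,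
and `exp(π/4) ≤ (1 − π/4)·e⁰ + (π/4)·e¹ < 1 + 0.7875·1.72 < 2.36 < 1 + √2` by convexity of `exp`,
`π < 3.15`, `e < 2.7182818286`, `1.41421 < √2`. [folklore] -/
theorem krivineBound_lt_two : krivineBound < 2 := by
  have hL := log_one_add_sqrt_two_pos
  have hpi := Real.pi_lt_d2
  have hpi0 := Real.pi_pos
  have he := Real.exp_one_lt_d9
  have he1 : (1:ℝ) < Real.exp 1 := by
    have := Real.add_one_lt_exp (one_ne_zero (α := ℝ)); linarith
  have hs : (1.41421 : ℝ) < Real.sqrt 2 := by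
    rw [Real.lt_sqrt (by norm_num)]; norm_num
  have hpos : (0 : ℝ) < 1 + Real.sqrt 2 := by linarith
  -- exp (π/4) < 1 + √2
  have hconv : Real.exp (Real.pi / 4) ≤ (1 - Real.pi / 4) * Real.exp 0 + (Real.pi / 4) * Real.exp 1 := by
    have h := (convexOn_exp).2 (Set.mem_univ (0:ℝ)) (Set.mem_univ (1:ℝ))
      (show (0:ℝ) ≤ 1 - Real.pi / 4 by linarith) (show (0:ℝ) ≤ Real.pi / 4 by linarith)
      (by ring)
    simpa [smul_eq_mul] using h
  have hexp : Real.exp (Real.pi / 4) < 1 + Real.sqrt 2 := by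
    rw [Real.exp_zero] at hconv
    have h1 : (1 - Real.pi / 4) * 1 + (Real.pi / 4) * Real.exp 1
        = 1 + (Real.pi / 4) * (Real.exp 1 - 1) := by ring
    have h2 : (Real.pi / 4) * (Real.exp 1 - 1) < (3.15 / 4) * (Real.exp 1 - 1) :=
      mul_lt_mul_of_pos_right (by linarith) (by linarith)
    have h3 : (3.15 / 4 : ℝ) * (Real.exp 1 - 1) < (3.15 / 4) * 1.7182818286 :=
      mul_lt_mul_of_pos_left (by linarith) (by norm_num)
    linarith
  have hlog : Real.pi / 4 < Real.log (1 + Real.sqrt 2) := by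
    rw [Real.lt_log_iff_exp_lt hpos]; exact hexp
  unfold krivineBound
  rw [div_lt_iff₀ (by positivity)]
  linarith

/-- **Grothendieck's inequality, factorization form, real discrete (rectangular) case** — a NAMED
FACT (not proved here). For every real `m × n` matrix `A` whose bilinear form is bounded by `M` on
sign vectors (`‖A‖_{∞→1} ≤ M`), there are nonnegative weights `μ` on the rows and `ν` on the
columns, each of total mass `≤ 1`, such that for all real `x, y`,
`|∑ᵢⱼ Aᵢⱼ xᵢ yⱼ| ≤ K · M · (∑ᵢ μᵢ xᵢ²)^{1/2} · (∑ⱼ νⱼ yⱼ²)^{1/2}` with `K = krivineBound = π/(2 log(1+√2))`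
(Krivine's bound on `K_G^ℝ`). This is [Pisier2011, Thm 2.1] with `S = [m]`, `T = [n]` (so
`C(S) = ℓ^m_∞` and `‖φ‖ = max over sign vectors`), equivalently [Tropp2008, Thm 12]
(`A = D₁TD₂`, `μ = diag D₁²`, `ν = diag D₂²`, `‖T‖ ≤ K_G‖A‖_{∞→1}`), combined with
`K_G^ℝ ≤ π/(2 log(1+√2))`. [cite: Pisier2011, Thm 2.1 p. 9 and §4 p. 16] -/
def GrothendieckFactorization : Prop :=
  ∀ (m n : ℕ) (A : Matrix (Fin m) (Fin n) ℝ) (M : ℝ),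
    (∀ (s : Fin m → ℝ) (t : Fin n → ℝ), (∀ i, s i = 1 ∨ s i = -1) → (∀ j, t j = 1 ∨ t j = -1) →
        |∑ i, ∑ j, A i j * s i * t j| ≤ M) →
    ∃ (μ : Fin m → ℝ) (ν : Fin n → ℝ), (∀ i, 0 ≤ μ i) ∧ (∀ j, 0 ≤ ν j) ∧
      ∑ i, μ i ≤ 1 ∧ ∑ j, ν j ≤ 1 ∧
      ∀ (x : Fin m → ℝ) (y : Fin n → ℝ), |∑ i, ∑ j, A i j * x i * y j| ≤
        krivineBound * M * Real.sqrt (∑ i, μ i * x i ^ 2) * Real.sqrt (∑ j, ν j * y j ^ 2)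

/-- Swapping the arguments of the bilinear form of a symmetric matrix. [folklore] -/
theorem bilin_swap_of_symm {n : ℕ} (A : Matrix (Fin n) (Fin n) ℝ) (hA : ∀ i j, A i j = A j i)
    (x y : Fin n → ℝ) :
    ∑ i, ∑ j, A i j * y i * x j = ∑ i, ∑ j, A i j * x i * y j := by
  rw [Finset.sum_comm]
  exact sum_congr rfl fun i _ => sum_congr rfl fun j _ => by rw [hA i j]; ring

/-- **Symmetric one-weight factorization** (PROVED from `GrothendieckFactorization`; Tropp's "when
`G` is Hermitian we may take `D₁ = D₂`" [Tropp2008, Thm 12]). If `A` is a real symmetric `n × n`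
matrix with `|sᵀAt| ≤ M` for all sign vectors `s, t`, there is ONE nonnegative weight `w` with
`∑ wᵢ ≤ 1` and `|xᵀAy| ≤ K·M·‖x‖_{L₂(w)}‖y‖_{L₂(w)}` for all real `x, y` (`K = krivineBound`).
Proof: with `μ, ν` from the fact put `w := (μ+ν)/2`; applying the fact to `(x,y)` and, by symmetry
of `A`, to `(y,x)` and multiplying, `|xᵀAy|² ≤ (KM)²(‖x‖_μ‖x‖_ν)(‖y‖_μ‖y‖_ν) ≤ (KM)²‖x‖²_w‖y‖²_w`
by `√a√b ≤ (a+b)/2`. [cite: Tropp2008, Thm 12 p. 10] -/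
theorem grothendieckFactorization_symm (hGT : GrothendieckFactorization) {n : ℕ}
    (A : Matrix (Fin n) (Fin n) ℝ) (hA : ∀ i j, A i j = A j i) {M : ℝ}
    (hM : ∀ s t : Fin n → ℝ, (∀ i, s i = 1 ∨ s i = -1) → (∀ j, t j = 1 ∨ t j = -1) →
      |∑ i, ∑ j, A i j * s i * t j| ≤ M) :
    ∃ w : Fin n → ℝ, (∀ i, 0 ≤ w i) ∧ ∑ i, w i ≤ 1 ∧
      ∀ x y : Fin n → ℝ, |∑ i, ∑ j, A i j * x i * y j| ≤
        krivineBound * M * Real.sqrt (∑ i, w i * x i ^ 2) * Real.sqrt (∑ i, w i * y i ^ 2) := by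
  obtain ⟨μ, ν, hμ, hν, hμ1, hν1, hfac⟩ := hGT n n A M hM
  set K := krivineBound with hKdef
  have hK : 0 < K := krivineBound_pos
  refine ⟨fun i => (μ i + ν i) / 2, fun i => by have := hμ i; have := hν i; positivity, ?_, ?_⟩
  · -- total mass
    have : ∑ i, (μ i + ν i) / 2 = ((∑ i, μ i) + ∑ i, ν i) / 2 := by
      rw [← Finset.sum_div, Finset.sum_add_distrib]
    rw [this]; linarith
  · intro x y
    -- the case `M < 0` is impossible unless `n = 0`, where everything vanishes
    rcases Nat.eq_zero_or_pos n with hn | hn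
    · subst hn; simp
    have hM0 : 0 ≤ M := by
      have h := hM (fun _ => 1) (fun _ => 1) (fun _ => Or.inl rfl) (fun _ => Or.inl rfl)
      exact le_trans (abs_nonneg _) h
    -- notation
    have hw : ∀ z : Fin n → ℝ, ∑ i, (μ i + ν i) / 2 * z i ^ 2
        = ((∑ i, μ i * z i ^ 2) + ∑ i, ν i * z i ^ 2) / 2 := by
      intro z
      rw [← Finset.sum_add_distrib, Finset.sum_div]
      exact sum_congr rfl fun i _ => by ring
    have ha : ∀ z : Fin n → ℝ, 0 ≤ ∑ i, μ i * z i ^ 2 :=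
      fun z => sum_nonneg fun i _ => mul_nonneg (hμ i) (sq_nonneg _)
    have hb : ∀ z : Fin n → ℝ, 0 ≤ ∑ i, ν i * z i ^ 2 :=
      fun z => sum_nonneg fun i _ => mul_nonneg (hν i) (sq_nonneg _)
    -- the two applications of the fact
    have h1 := hfac x y
    have h2 := hfac y x
    rw [bilin_swap_of_symm A hA x y] at h2
    set P := |∑ i, ∑ j, A i j * x i * y j| with hPdef
    have hP : 0 ≤ P := abs_nonneg _
    set ax := Real.sqrt (∑ i, μ i * x i ^ 2)
    set bx := Real.sqrt (∑ i, ν i * x i ^ 2)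
    set ay := Real.sqrt (∑ i, μ i * y i ^ 2)
    set by_ := Real.sqrt (∑ i, ν i * y i ^ 2)
    have hax : 0 ≤ ax := Real.sqrt_nonneg _
    have hbx : 0 ≤ bx := Real.sqrt_nonneg _
    have hay : 0 ≤ ay := Real.sqrt_nonneg _
    have hby : 0 ≤ by_ := Real.sqrt_nonneg _
    -- W_x, W_y and the AM–GM step
    set Wx := ∑ i, (μ i + ν i) / 2 * x i ^ 2
    set Wy := ∑ i, (μ i + ν i) / 2 * y i ^ 2
    -- AM–GM: `√a·√b ≤ (a+b)/2` (the same elementary step appears in other tree files; inlined)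
    have amgm : ∀ {a b : ℝ}, 0 ≤ a → 0 ≤ b → Real.sqrt a * Real.sqrt b ≤ (a + b) / 2 := by
      intro a b ha' hb'
      have h := two_mul_le_add_sq (Real.sqrt a) (Real.sqrt b)
      rw [Real.sq_sqrt ha', Real.sq_sqrt hb'] at h
      linarith
    have hWx : ax * bx ≤ Wx := by
      have := amgm (ha x) (hb x)
      rw [← hw x] at this; exact this
    have hWy : ay * by_ ≤ Wy := by
      have := amgm (ha y) (hb y)
      rw [← hw y] at this; exact this
    have hWx0 : 0 ≤ Wx := le_trans (mul_nonneg hax hbx) hWx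
    have hWy0 : 0 ≤ Wy := le_trans (mul_nonneg hay hby) hWy
    -- P² ≤ (K M)² Wx Wy
    have hKM : 0 ≤ K * M := mul_nonneg hK.le hM0
    have hsq : P ^ 2 ≤ (K * M * Real.sqrt Wx * Real.sqrt Wy) ^ 2 := by
      have hPP : P * P ≤ (K * M * ax * by_) * (K * M * ay * bx) :=
        mul_le_mul h1 h2 hP (le_trans hP h1)
      have hre : (K * M * ax * by_) * (K * M * ay * bx) = (K * M) ^ 2 * ((ax * bx) * (ay * by_)) := by
        ring
      have hprod : (ax * bx) * (ay * by_) ≤ Wx * Wy :=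
        mul_le_mul hWx hWy (mul_nonneg hay hby) hWx0
      calc P ^ 2 = P * P := sq P
        _ ≤ (K * M) ^ 2 * ((ax * bx) * (ay * by_)) := by rw [← hre]; exact hPP
        _ ≤ (K * M) ^ 2 * (Wx * Wy) := mul_le_mul_of_nonneg_left hprod (sq_nonneg _)
        _ = (K * M * Real.sqrt Wx * Real.sqrt Wy) ^ 2 := by
            rw [show (K * M * Real.sqrt Wx * Real.sqrt Wy) ^ 2
                = (K * M) ^ 2 * ((Real.sqrt Wx) ^ 2 * (Real.sqrt Wy) ^ 2) by ring,
              Real.sq_sqrt hWx0, Real.sq_sqrt hWy0]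
    have hR : 0 ≤ K * M * Real.sqrt Wx * Real.sqrt Wy :=
      mul_nonneg (mul_nonneg hKM (Real.sqrt_nonneg _)) (Real.sqrt_nonneg _)
    exact le_of_pow_le_pow_left₀ two_ne_zero hR hsq

end Literature.Analysis.Matrix
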